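import Mathlib.LinearAlgebra.PiTensorProduct.Basis
import Mathlib.RingTheory.TensorProduct.Free
import Mathlib.RingTheory.TensorProduct.Basic
import HarnessLib

/-!
# Base change of finite tensor products of free modules:
# `A ⊗_𝒪 (⨂_{i,𝒪} M_i) ≅ ⨂_{i,A} (A ⊗_𝒪 M_i)`

Topic `LinearAlgebra/BaseChange`; namespace `Literature.LinearAlgebra.BaseChange`; one definition
with a body and theorems.

For an `𝒪`-algebra `A`, a FINITE index type `ι` and FREE `𝒪`-modules `M_i` with bases `b_i`, the
`A`-linear equivalence `piTensorBaseChange b : A ⊗[𝒪] (⨂[𝒪] i, M i) ≃ₗ[A] ⨂[A] i, (A ⊗[𝒪] M i)`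
matching the tensor bases (Mathlib `Basis.piTensorProduct`, `Algebra.TensorProduct.basis`), with

* `piTensorBaseChange_tmul : a ⊗ (⊗_i m_i) ↦ a • ⊗_i (1 ⊗ m_i)` (so the equivalence does not
  depend on the bases), `piTensorBaseChange_symm_tprod_tmul : ⊗_i (a_i ⊗ m_i) ↦ (∏ a_i) ⊗ ⊗_i m_i`;
* `piTensorBaseChange_map` — **naturality** in `𝒪`-linear maps `f_i : M_i → N_i`:
  base change commutes with `⨂_i f_i` (Bourbaki, *Algebra* II §5 no. 1 / §7 no. 7: extension of
  scalars commutes with tensor products).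

Used for the `ϖ`-adic lattices `⨂_τ Sym^{k−2}(𝒪²)` of Hida theory and their reductions
`A = 𝒪/ϖ^r` ([KhareThorne2017, §6.4]).

## References

* N. Bourbaki, *Algebra I*, Ch. II §5 no. 1, §7 no. 7. [folklore]
* C. Khare, J. A. Thorne, Amer. J. Math. 139 (2017), §6.4 (arXiv:1409.7007). [KhareThorne2017]
-/

noncomputable section

open scoped TensorProduct
open PiTensorProduct

namespace Literature.LinearAlgebra.BaseChange

universe u v w w'

variable {O : Type u} {A : Type u} [CommRing O] [CommRing A] [Algebra O A] {ι : Type v} [Finite ι]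
  {M : ι → Type w} [∀ i, AddCommGroup (M i)] [∀ i, Module O (M i)]
  {κ : ι → Type w'} (b : ∀ i, Module.Basis (κ i) O (M i))

variable (A) in
/-- The `𝒪`-multilinear map `(m_i)_i ↦ ⊗_i (1 ⊗ m_i)`. [folklore] -/
def tprodOneTmul (M : ι → Type w) [∀ i, AddCommGroup (M i)] [∀ i, Module O (M i)] :
    MultilinearMap O M (⨂[A] i, (A ⊗[O] M i)) :=
  ((PiTensorProduct.tprod A : MultilinearMap A (fun i => A ⊗[O] M i) _).restrictScalars O).compLinearMap
    fun i => TensorProduct.mk O A (M i) 1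

omit [Finite ι] in
/-- Unfolding `tprodOneTmul`. [folklore] -/
@[simp]
theorem tprodOneTmul_apply (M : ι → Type w) [∀ i, AddCommGroup (M i)] [∀ i, Module O (M i)]
    (m : ∀ i, M i) : tprodOneTmul A M m = tprod A fun i => (1 : A) ⊗ₜ[O] m i :=
  rfl

variable (A) in
/-- The base-change map `A ⊗ (⊗_i M_i) → ⊗_i (A ⊗ M_i)`, `a ⊗ (⊗ m_i) ↦ a • ⊗ (1 ⊗ m_i)` (defined
for all modules; an isomorphism for free ones). [folklore] -/
def piTensorBaseChangeHom (M : ι → Type w) [∀ i, AddCommGroup (M i)] [∀ i, Module O (M i)] :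
    A ⊗[O] (⨂[O] i, M i) →ₗ[A] ⨂[A] i, (A ⊗[O] M i) :=
  (PiTensorProduct.lift (tprodOneTmul A M)).liftBaseChange A

omit [Finite ι] in
/-- `piTensorBaseChangeHom (a ⊗ ⊗_i m_i) = a • ⊗_i (1 ⊗ m_i)`. [folklore] -/
@[simp]
theorem piTensorBaseChangeHom_tmul (M : ι → Type w) [∀ i, AddCommGroup (M i)] [∀ i, Module O (M i)]
    (a : A) (m : ∀ i, M i) :
    piTensorBaseChangeHom A M (a ⊗ₜ tprod O m) = a • tprod A fun i => (1 : A) ⊗ₜ[O] m i := by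
  rw [piTensorBaseChangeHom, LinearMap.liftBaseChange_tmul, PiTensorProduct.lift.tprod, tprodOneTmul_apply]

/-- **`A ⊗_𝒪 (⨂_{i,𝒪} M_i) ≅ ⨂_{i,A} (A ⊗_𝒪 M_i)` for free `M_i` and finite `ι`**, matching the
tensor bases. [folklore] -/
def piTensorBaseChange : A ⊗[O] (⨂[O] i, M i) ≃ₗ[A] ⨂[A] i, (A ⊗[O] M i) :=
  (Algebra.TensorProduct.basis A (Basis.piTensorProduct b)).equiv
    (Basis.piTensorProduct fun i => Algebra.TensorProduct.basis A (b i)) (Equiv.refl _)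

/-- `piTensorBaseChange` is the base-change map (in particular independent of the bases).
[folklore] -/
theorem piTensorBaseChange_toLinearMap :
    (piTensorBaseChange (A := A) b).toLinearMap = piTensorBaseChangeHom A M := by
  refine (Algebra.TensorProduct.basis A (Basis.piTensorProduct b)).ext fun p => ?_
  rw [LinearEquiv.coe_coe, piTensorBaseChange, Module.Basis.equiv_apply, Equiv.refl_apply,
    Algebra.TensorProduct.basis_apply, Basis.piTensorProduct_apply, Basis.piTensorProduct_apply,
    piTensorBaseChangeHom_tmul, one_smul]
  exact congrArg _ (funext fun i => (Algebra.TensorProduct.basis_apply (b i) (p i)))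

/-- **`piTensorBaseChange (a ⊗ ⊗_i m_i) = a • ⊗_i (1 ⊗ m_i)`.** [folklore] -/
@[simp]
theorem piTensorBaseChange_tmul (a : A) (m : ∀ i, M i) :
    piTensorBaseChange (A := A) b (a ⊗ₜ tprod O m) = a • tprod A fun i => (1 : A) ⊗ₜ[O] m i := by
  rw [← LinearEquiv.coe_coe, piTensorBaseChange_toLinearMap, piTensorBaseChangeHom_tmul]

/-- **`piTensorBaseChange.symm (⊗_i (a_i ⊗ m_i)) = (∏ a_i) ⊗ ⊗_i m_i`.** [folklore] -/
theorem piTensorBaseChange_symm_tprod_tmul [Fintype ι] (a : ι → A) (m : ∀ i, M i) :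
    (piTensorBaseChange (A := A) b).symm (tprod A fun i => a i ⊗ₜ[O] m i) =
      (∏ i, a i) ⊗ₜ tprod O m := by
  rw [LinearEquiv.symm_apply_eq, piTensorBaseChange_tmul,
    ← MultilinearMap.map_smul_univ (tprod A) a fun i => (1 : A) ⊗ₜ[O] m i]
  exact congrArg _ (funext fun i => by rw [TensorProduct.smul_tmul', smul_eq_mul, mul_one])

/-! ### Naturality -/

variable {N : ι → Type w} [∀ i, AddCommGroup (N i)] [∀ i, Module O (N i)]
  {κ' : ι → Type w'} (c : ∀ i, Module.Basis (κ' i) O (N i))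

/-- **Base change commutes with `⨂_i f_i`.** [folklore] -/
theorem piTensorBaseChange_map (f : ∀ i, M i →ₗ[O] N i) (x : A ⊗[O] (⨂[O] i, M i)) :
    piTensorBaseChange (A := A) c ((PiTensorProduct.map f).baseChange A x) =
      PiTensorProduct.map (fun i => (f i).baseChange A) (piTensorBaseChange (A := A) b x) := by
  induction x using TensorProduct.induction_on with
  | zero => simp only [map_zero]
  | tmul a y =>
    rw [LinearMap.baseChange_tmul]
    induction y using PiTensorProduct.induction_on generalizing a with
    | smul_tprod r m =>
      rw [map_smul, PiTensorProduct.map_tprod, ← TensorProduct.smul_tmul, ← TensorProduct.smul_tmul,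
        piTensorBaseChange_tmul, piTensorBaseChange_tmul, map_smul, PiTensorProduct.map_tprod]
      simp only [LinearMap.baseChange_tmul]
    | add y z hy hz =>
      rw [map_add, TensorProduct.tmul_add, TensorProduct.tmul_add, map_add, map_add, hy, hz, map_add]
  | add x y hx hy => rw [map_add, map_add, hx, hy, map_add, map_add]

end Literature.LinearAlgebra.BaseChange
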